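import Summits.QuantumFields.YangMills.Theorems.BalabanUVNodesN07SymCurrencyReader
import Summits.QuantumFields.YangMills.Theorems.BalabanUVNodesN07Thm4RecordStructureSym152Phi
import Summits.QuantumFields.YangMills.Theorems.BalabanUVNodesN07ShearedFrameLetters
import HarnessLib

/-!
# N07 [B11] (= [15] = [Balaban1985Variational]) Sect. F — MODULE 93″ (plan g93 A3⁵ ∕ director №311a (β), chart side (III)): **THE READER UNDER THE φ-b₂ PREMISE** — with row 9′ only up to a
# displayed defect `ψ` («`‖R̄^{j′}(h̄·w·u⁻¹)(y) − 1‖ ≤ ψ` on the cells of `D″`», `NrmSymPhiOfRecord`), the block averages `ρ̄ := R̄^{l}(h̄·w·u⁻¹)` at the two ends of EVERY constraint bond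
# `c : BondIdx D″` are within `6ψ` of `1` (cells by the premise; out-ends over a block of cells by one step of [3] (80): `exp[mean log]` of a `2ψ`-small family), and the double-bar averages
# of the Landau copy read `U̿(c) = (V c₋)⁻¹·S(c₋)·ρ̄(c₋)⁻¹ · Ū_eml((U^{h̄w})♮)(c) · ρ̄(c₊)·S(c₊)⁻¹·V c₊` (MODULE 93′'s twisted identity) — the input of the near rows 96′∕97′ under (β)

Cell `pub-ymgap`, seat `pub-ymgap-dag-n07-e` g30 (FAN-OUT §N07 row s3; LANE OWNER of the K0 road chart side).  `--kind proof --supports stmt-QuantumFields-20541 --as helper` (K0⁷);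
count-neutral; THEOREMS ONLY (0 `def`).  [3] = [Balaban1985Averaging]; [15] = [Balaban1985Variational]; [4] = [Balaban1984PropagatorsII]; [I] = [Balaban1987RG1].

WHAT IS PROVED (sorry-free; axioms standard).
* §1 (generic `P`, `SU(N)`): `norm_coe_gaugeAvgF_sub_one_le` (one (78) step on a block where the gauge function is within `ψ ≤ 1∕32` of `1`: `R̄v(y)` within `6ψ`),
  ★ `norm_coe_gaugeAvgIter_lamBond_end_sub_one_le` (φ-twin of MODULE 61 `gaugeAvgIter_lamBond_end_eq_one`: cells within `ψ` ⇒ both ends of every constraint bond within `6ψ`, `Adm22 D R M`,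
  `2L ≤ R·M + 1`).
* §2 AT THE RECORD ★★★ `NrmSymPhiOfRecord.dbar_eq_conj_twist_lamBond`: under `NrmSymPhiOfRecord F N Mc ρ ψ … u A` (`ψ ≤ 1∕32`) and `Adm22 D″ R M_b`, for the witness `w` and EVERY accumulated-frame family
  `V` of `(U^u)♮`: at every constraint bond `b` of `D″` (level `l`, stated bond-wise) the twisted identity of MODULE 93′ with `ρ̄ := R̄^{l}(h̄·w·u⁻¹)` AND `‖ρ̄(b₋) − 1‖ ≤ 6ψ`, `‖ρ̄(b₊) − 1‖ ≤ 6ψ`.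
HONEST SCOPE: identities + one `exp[mean log]` closeness step (✓`…N07ShearedFrameLetters.norm_coe_avg_sub_one_le`); nothing of [15]∕[3]∕[I] analysis asserted; `NrmSymPhiOfRecord` is a displayed
premise row (CONDITIONAL); K0⁷ NOT closed; N07 NOT discharged; counts unmoved; one finite 𝕋⁴ programme at fixed ε — the route closes the conditional finite-𝕋⁴ rung `BalabanLadder.UV` ONLY; the YM
mass gap (Clay) is NOT proved by any of this; nothing continuum ∕ ℝ⁴ ∕ OS.  No `def`, no `instance`, no `notation`, no `sorry`.

References: [3] (26)–(27) p. 22, (78)–(81) p. 30, (84)–(88) p. 31, (92) p. 31, (97) p. 32; [15] (150)–(154) pp. 301–302; [4] (2.1)–(2.3) p. 224; [I] (0.4), (0.11) p. 253.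
-/

set_option autoImplicit false

noncomputable section

open scoped Matrix.Norms.L2Operator

namespace Summit.QuantumFields.YangMills.BalabanUVNodes.N07SymCurrencyReaderPhi

open Literature.MathematicalPhysics.QuantumFieldTheory.Balaban1983to89
open Literature.MathematicalPhysics.QuantumFieldTheory.Balaban1983to89.Node00
open T4Continuum (T4Family)
open T4AxialGaugeRooted (axialGaugeAt)
open B12GaugeOrbits021 (IsResidual)
open B15Eq177GaugeInvariance (blockLift)
open B16Sect1Backgrounds (toMS)
open B6SectADomainsV1 (Domains)
open B6SectAOperatorsV1 (BondIdx)
open GaugeField (gaugeAct)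
open ExpMeanLog (expMeanLogSU)
open B10Eq27TorusAxialLog (unitsField toUField)
open B14DomainGeom (Pt)
open B8Eq131Cubes (tLo tHi ctr)
open Summit.QuantumFields.YangMills.Theorems.Prop8Chart (emlIterU)
open Summit.QuantumFields.YangMills.Theorems.Prop8ChartDoubleBar (vframeU dbarIterU)
open Summit.QuantumFields.YangMills.Theorems.FlatCubeOpsText (Adm22)
open Summit.QuantumFields.YangMills.BalabanUVNodes.N07NormalisationDbarFrames (toUT)
open Summit.QuantumFields.YangMills.BalabanUVNodes.N07NormalisationOfRecord (gaugeAct_rep_of_landau)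
open Summit.QuantumFields.YangMills.BalabanUVNodes.N07NormalisationSymOfRecord (symCd symCd_hctr symTower_gaugeAct_blockLift)
open Summit.QuantumFields.YangMills.BalabanUVNodes.N07NormalisationCrossingEnds (lamSite_ends_of_lamBond_zero lamSite_or_forall_block_of_lamBond_end)
open Summit.QuantumFields.YangMills.BalabanUVNodes.N07SymCurrencyReader (toUT_toMS_eq_shear_mul_twist dbar_eq_conj_eml_twist)
open Summit.QuantumFields.YangMills.BalabanUVNodes.N07Thm4RecordStructureSym152Phi (NrmSymPhiOfRecord)
open Summit.QuantumFields.YangMills.BalabanUVNodes.N07ShearedFrameLetters (norm_coe_avg_sub_one_le norm_coe_mul_sub_one_le norm_coe_inv_mul_mul_sub_one_eq coe_mem_unitary)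

variable {P : Params} {N : ℕ} [NeZero N]

/-! ## §1  One step of [3] (80) on a block where the gauge function is near `1`; the ends of a constraint bond -/

/-- **(78) on a block of near-`1` values**: if `‖v(x) − 1‖ ≤ ψ ≤ 1∕32` for every `x ∈ B(y)` (standing range), then `‖(R̄v)(y) − 1‖ ≤ 6ψ` — `R̄v(y) = v(ȳ)·𝓔_y{v(ȳ)⁻¹v(x)}`, the members
within `2ψ`, `exp[mean log]` within `2(2ψ) + 8(2ψ)²` (either branch of the guard). [cite: Balaban1985Averaging, (78) p.30, (26)–(27) p.22] -/
theorem norm_coe_gaugeAvgF_sub_one_le {i : ℕ} (hi : i + 1 ≤ P.m + P.K) {v : GaugeTransf P i (SU N)} {y : Site P (i + 1)} {ψ : ℝ} (hψ : ψ ≤ 1 / 32)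
    (hv : ∀ x : Site P i, blockOf x = y → ‖((v x : SU N) : Matrix (Fin N) (Fin N) ℂ) - 1‖ ≤ ψ) :
    ‖((gaugeAvgF (loopAvgBlockOp expMeanLogSU i) v y : SU N) : Matrix (Fin N) (Fin N) ℂ) - 1‖ ≤ 6 * ψ := by
  have hψ0 : 0 ≤ ψ := (norm_nonneg _).trans (hv (emb y) (Site.blockOf_emb hi y))
  have hc := hv (emb y) (Site.blockOf_emb hi y)
  -- the members `v(ȳ)⁻¹ v(x)` are within `2ψ`
  have hmem : ∀ r : Fin P.d → Fin P.L, ‖(((v (emb y))⁻¹ * v (Site.blockSite y r) : SU N) : Matrix (Fin N) (Fin N) ℂ) - 1‖ ≤ 2 * ψ := by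
    intro r
    have h := norm_coe_inv_mul_mul_sub_one_eq (v (emb y)) (v (Site.blockSite y r)) 1
    rw [mul_one, mul_one] at h
    rw [h]
    have h1 : ((v (Site.blockSite y r) : SU N) : Matrix (Fin N) (Fin N) ℂ) - ((v (emb y) : SU N) : Matrix (Fin N) (Fin N) ℂ) =
        (((v (Site.blockSite y r) : SU N) : Matrix (Fin N) (Fin N) ℂ) - 1) - (((v (emb y) : SU N) : Matrix (Fin N) (Fin N) ℂ) - 1) := by abel
    rw [h1]
    refine (norm_sub_le _ _).trans ?_
    linarith [hv _ (Site.blockOf_blockSite hi y r)]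
  unfold gaugeAvgF
  rw [loopAvgBlockOp_eq _ hi]
  refine (norm_coe_mul_sub_one_le _ _).trans ?_
  have hE := norm_coe_avg_sub_one_le (fun r : Fin P.d → Fin P.L => (v (emb y))⁻¹ * v (Site.blockSite y r)) hmem (by linarith)
  nlinarith [hE, hc, hψ0]

/-- ★ **CELLS WITHIN `ψ` ⇒ BOTH ENDS OF EVERY CONSTRAINT BOND WITHIN `6ψ`** (φ-twin of MODULE 61 `gaugeAvgIter_lamBond_end_eq_one`; `Adm22 D R M`, `2L ≤ R·M + 1`, `0 ≤ ψ ≤ 1∕32`): an end is a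
cell (bound `ψ ≤ 6ψ`) or lies over a block of cells one level down (§1). [cite: Balaban1985Averaging, (78)–(81) p.30; Balaban1984PropagatorsII, (2.1)–(2.3) p.224; Balaban1985Variational, (152) p.301] -/
theorem norm_coe_gaugeAvgIter_lamBond_end_sub_one_le (D : Domains P) {R M : ℕ} (hAdm : Adm22 D R M) (hRM : 2 * P.L ≤ R * M + 1)
    (g : GaugeTransf P 0 (SU N)) {ψ : ℝ} (hψ0 : 0 ≤ ψ) (hψ : ψ ≤ 1 / 32)
    (hcells : ∀ j' : ℕ, j' ≤ D.k → ∀ y : Site P j', D.LamSite j' y →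
      ‖((gaugeAvgIter (loopAvgBlockOp expMeanLogSU) g j' y : SU N) : Matrix (Fin N) (Fin N) ℂ) - 1‖ ≤ ψ) :
    ∀ (n : ℕ) (e : PBond P n), D.LamBond n e → ∀ y : Site P n, (y = e.src ∨ y = e.tgt) →
      ‖((gaugeAvgIter (loopAvgBlockOp expMeanLogSU) g n y : SU N) : Matrix (Fin N) (Fin N) ℂ) - 1‖ ≤ 6 * ψ
  | 0, e, he, y, hy => by
      refine (hcells 0 (Nat.zero_le _) y ?_).trans (by linarith)
      rcases hy with rfl | rfl
      · exact (lamSite_ends_of_lamBond_zero D he).1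
      · exact (lamSite_ends_of_lamBond_zero D he).2
  | i + 1, e, he, y, hy => by
      have hk : i + 1 ≤ D.k := D.le_of_lamBond he
      have hi1 : i + 1 ≤ P.m + P.K := hk.trans D.hk
      rcases lamSite_or_forall_block_of_lamBond_end D hAdm hRM he hy with hcell | hblock
      · exact (hcells _ hk y hcell).trans (by linarith)
      · rw [gaugeAvgIter_succ]
        exact norm_coe_gaugeAvgF_sub_one_le hi1 hψ fun z hz => hcells i (by omega) z (hblock z hz)

/-! ## §2  At the record: the twisted reading under `NrmSymPhiOfRecord` on EVERY constraint bond of `D″` -/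

section Record

variable {F : T4Family}

/-- ★★★ **THE READING UNDER THE φ-b₂ PREMISE ON THE CHART's WHOLE INDEX SET.**  Under `NrmSymPhiOfRecord F N Mc ρ ψ ν M g K k s U j idx u A` (`0 ≤ ψ ≤ 1∕32`) and `Adm22 D″ R M_b`
(`2L ≤ R·M_b + 1`): for the witness `w` (residual, `symCd`-axial tower) and EVERY family `V` of accumulated double-bar frames of `(U^u)♮`, at EVERY `c : BondIdx D″`,
`U̿^{(j(c))}(U^u)♮(c) = (V c₋)⁻¹·S(c₋)·ρ̄(c₋)⁻¹ · Ū^{(j(c))}_{eml}((U^{h̄w})♮)(c) · (ρ̄(c₊)·S(c₊)⁻¹·V c₊)` with `ρ̄ := R̄^{j(c)}(h̄·w·u⁻¹)` and BOTH `‖ρ̄(c₋) − 1‖, ‖ρ̄(c₊) − 1‖ ≤ 6ψ` — MODULE 93′'s twist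
(`toUT_toMS_eq_shear_mul_twist` at both ends, `dbar_eq_conj_eml_twist`) and §1.
[cite: Balaban1985Variational, (150)–(154) pp.301–302, (160) p.303; Balaban1985Averaging, (78)–(81) p.30, (84)–(88) p.31, (92) p.31, (97) p.32; Balaban1984PropagatorsII, (2.1)–(2.3) p.224; Balaban1987RG1, (0.11) p.253] -/
theorem NrmSymPhiOfRecord.dbar_eq_conj_twist_lamBond {Mc ρ : ℕ} {ψ : ℝ} (hψ0 : 0 ≤ ψ) (hψ : ψ ≤ 1 / 32) {ν : Stage7Numerics} {M : ℕ} {g : ℕ → ℝ} {K k : ℕ}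
    {s : SeqOfRecord F ν M g K k} {U : GaugeField (F.P K) 0 (SU N)} {j : ℕ} {idx : Pt (F.P K).d} {u : GaugeTransf (F.P K) 0 (SU N)} {A : PBond (F.P K) 0 → MatA N}
    (hN : NrmSymPhiOfRecord F N Mc ρ ψ ν M g K k s U j idx u A) (hk : j ≤ (F.P K).m + (F.P K).K) {R Mb : ℕ}
    (hAdm : Adm22 (domainsMeet (cubeDomains (F.P K) (cornerP (F.P K) Mc ρ idx) (sideP (F.P K) Mc ρ) ρ j hk) (domainsOfSeq s.Ω j hk)) R Mb)
    (hRM : 2 * (F.P K).L ≤ R * Mb + 1)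
    (V : (i : ℕ) → Site (F.P K) i → (Matrix (Fin N) (Fin N) ℂ)ˣ) (hV0 : ∀ x, V 0 x = 1)
    (hVs : ∀ (i : ℕ) (y : Site (F.P K) (i + 1)), V (i + 1) y = V i (emb y) * vframeU (dbarIterU i (unitsField (toUField (gaugeAct u U)))) y) :
    ∃ w : GaugeTransf (F.P K) 0 (SU N), IsResidual j w ∧
      (∀ i < j, AxialGauge (symCd F N K i) (Averaging.iter (avOfRecord F N K) i (gaugeAct w U))) ∧
      ∀ (l : ℕ) (b : PBond (F.P K) l),
        (domainsMeet (cubeDomains (F.P K) (cornerP (F.P K) Mc ρ idx) (sideP (F.P K) Mc ρ) ρ j hk) (domainsOfSeq s.Ω j hk)).LamBond l b →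
        dbarIterU l (unitsField (toUField (gaugeAct u U))) b =
          (V l b.src)⁻¹ *
              toUT (shearRIter (avOfRecord F N K) (fun i => symCd F N K i) (loopAvgBlockOp expMeanLogSU) (gaugeAct u U) l) b.src *
              (toUT (gaugeAvgIter (loopAvgBlockOp expMeanLogSU) (fun x => blockLift j (axialGaugeAt (Averaging.iter (avOfRecord F N K) j (gaugeAct w U))
                (tLo (cornerP (F.P K) Mc ρ idx) ρ) (tHi (cornerP (F.P K) Mc ρ idx) (sideP (F.P K) Mc ρ) ρ) (ctr (cornerP (F.P K) Mc ρ idx) (sideP (F.P K) Mc ρ))) x * w x * (u x)⁻¹)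
                l) b.src)⁻¹ *
            emlIterU l (unitsField (toUField (gaugeAct (fun x => blockLift j (axialGaugeAt (Averaging.iter (avOfRecord F N K) j (gaugeAct w U))
              (tLo (cornerP (F.P K) Mc ρ idx) ρ) (tHi (cornerP (F.P K) Mc ρ idx) (sideP (F.P K) Mc ρ) ρ) (ctr (cornerP (F.P K) Mc ρ idx) (sideP (F.P K) Mc ρ))) x * w x) U))) b *
            (toUT (gaugeAvgIter (loopAvgBlockOp expMeanLogSU) (fun x => blockLift j (axialGaugeAt (Averaging.iter (avOfRecord F N K) j (gaugeAct w U))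
                (tLo (cornerP (F.P K) Mc ρ idx) ρ) (tHi (cornerP (F.P K) Mc ρ idx) (sideP (F.P K) Mc ρ) ρ) (ctr (cornerP (F.P K) Mc ρ idx) (sideP (F.P K) Mc ρ))) x * w x * (u x)⁻¹)
                l) b.tgt *
              (toUT (shearRIter (avOfRecord F N K) (fun i => symCd F N K i) (loopAvgBlockOp expMeanLogSU) (gaugeAct u U) l) b.tgt)⁻¹ *
              V l b.tgt) ∧
        ‖((gaugeAvgIter (loopAvgBlockOp expMeanLogSU) (fun x => blockLift j (axialGaugeAt (Averaging.iter (avOfRecord F N K) j (gaugeAct w U))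
            (tLo (cornerP (F.P K) Mc ρ idx) ρ) (tHi (cornerP (F.P K) Mc ρ idx) (sideP (F.P K) Mc ρ) ρ) (ctr (cornerP (F.P K) Mc ρ idx) (sideP (F.P K) Mc ρ))) x * w x * (u x)⁻¹)
            l b.src : SU N) : Matrix (Fin N) (Fin N) ℂ) - 1‖ ≤ 6 * ψ ∧
        ‖((gaugeAvgIter (loopAvgBlockOp expMeanLogSU) (fun x => blockLift j (axialGaugeAt (Averaging.iter (avOfRecord F N K) j (gaugeAct w U))
            (tLo (cornerP (F.P K) Mc ρ idx) ρ) (tHi (cornerP (F.P K) Mc ρ idx) (sideP (F.P K) Mc ρ) ρ) (ctr (cornerP (F.P K) Mc ρ idx) (sideP (F.P K) Mc ρ))) x * w x * (u x)⁻¹)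
            l b.tgt : SU N) : Matrix (Fin N) (Fin N) ℂ) - 1‖ ≤ 6 * ψ := by
  obtain ⟨w, hres, hax, hnorm⟩ := hN
  refine ⟨w, hres, hax, fun l b hb => ?_⟩
  have hDk : (domainsMeet (cubeDomains (F.P K) (cornerP (F.P K) Mc ρ idx) (sideP (F.P K) Mc ρ) ρ j hk) (domainsOfSeq s.Ω j hk)).k ≤ j := by
    show min j j ≤ j
    exact min_le_left _ _
  have hcj : l ≤ j := ((domainsMeet _ _).le_of_lamBond hb).trans hDk
  have hcK : l ≤ (F.P K).m + (F.P K).K := hcj.trans hk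
  have hends := norm_coe_gaugeAvgIter_lamBond_end_sub_one_le _ hAdm hRM _ hψ0 hψ
    (fun j' hj' y hy => hnorm hk j' (hj'.trans hDk) y hy) l b hb
  -- the axial tower of `(U^u)^{g} = (U^w)^{h̄}` below `l`
  have hax' : ∀ i < l, AxialGauge (symCd F N K i)
      (Averaging.iter (avOfRecord F N K) i (gaugeAct (fun x => blockLift j (axialGaugeAt (Averaging.iter (avOfRecord F N K) j (gaugeAct w U))
        (tLo (cornerP (F.P K) Mc ρ idx) ρ) (tHi (cornerP (F.P K) Mc ρ idx) (sideP (F.P K) Mc ρ) ρ) (ctr (cornerP (F.P K) Mc ρ idx) (sideP (F.P K) Mc ρ))) x * w x * (u x)⁻¹)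
        (gaugeAct u U))) := by
    rw [gaugeAct_rep_of_landau]
    exact fun i hi => symTower_gaugeAct_blockLift F N K hk _ _ hax i (lt_of_lt_of_le hi hcj)
  refine ⟨dbar_eq_conj_eml_twist U u _ _ _ V hV0 hVs b
    (toUT_toMS_eq_shear_mul_twist (avOfRecord F N K) (fun i => symCd F N K i) (loopAvgBlockOp expMeanLogSU)
      (fun i y f f' h => loopAvgBlockOp_local expMeanLogSU i y f f' h) (symCd_hctr F N K) U u _ hcK hax' _)
    (toUT_toMS_eq_shear_mul_twist (avOfRecord F N K) (fun i => symCd F N K i) (loopAvgBlockOp expMeanLogSU)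
      (fun i y f f' h => loopAvgBlockOp_local expMeanLogSU i y f f' h) (symCd_hctr F N K) U u _ hcK hax' _),
    hends _ (Or.inl rfl), hends _ (Or.inr rfl)⟩

end Record

end Summit.QuantumFields.YangMills.BalabanUVNodes.N07SymCurrencyReaderPhi

end
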